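import Summits.BirchSwinnertonDyer.BirchSwinnertonDyer.Theorems.EisensteinPrimesBSDpOnCellCOfCitedFactsV19
import Summits.BirchSwinnertonDyer.BirchSwinnertonDyer.Theorems.EisensteinPrimesBSDpOnCellCTelescopeBranchFrobeniusLatticeOfChart
import HarnessLib

/-!
# [telescope v20 — successor LEAD cruxlead-19034 <gN>, <date>] CRUX 4 `BSDpOnCellC` FROM THE RATIONAL-CHART CITED FACT T-An-2ʳ AND CRUX 3 — CONDITIONAL CLOSURE, SORRY-FREE (sibling of p769883 / p775405 / p777408)
# Crux 4 `BSDpOnCellC` (stmt-BirchSwinnertonDyer-19034), line «telescope» v20 (`--supports`, helper; CONDITIONAL — closes nothing)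

WHAT: `bsdpOnCellC_of_citedFactsR (hPub) (hPre) (hRat) (hMazur) : …Theses.EisensteinPrimes.BSDpOnCellC` with `hPub`/`hPre`/`hMazur` the texts of v17–v20's `stub_publishedFacts`
(23 refereed named facts) / `stub_preprintFacts` (Keller–Yin 2024 ×4) / `stub_mazurMC_cellB` (crux 3) token for token, and `hRat` = the v20 assembled cite stub's fact T-An-2ʳ
`Literature.NumberTheory.EllipticCurves.hida1986_castella2020_exists_rationalMembers_on_pNewBranchChart` (idea-12 g44, p780084: Castella's chart + two-variable BDP verbatim + `ℚ_p`-rational members; NO Galois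
representation cited). PROOF = ONE LINE: the v19 closure `EisensteinPrimesBSDpOnCellCOfCitedFactsV19.bsdpOnCellC_of_citedFactsF` (LEAD g6 p777408) with `hGal` CONSTRUCTED from `hRat` by the LANDED
kernel bridge `Summit.BirchSwinnertonDyer.BirchSwinnertonDyer.Theorems.TelescopeBranchFrobeniusLatticeOfChart.frobeniusGaloisLattice_of_rationalMembers` (p781788: Wiles' pseudo-representation method in the tree — bricks B1/B3/B4′, G0–G3, G5).

HONEST FRAMING: CONDITIONAL result (the gate records it as such); it discharges none of its four hypotheses; closes no registered stub, no crux, no summit statement; BSD is proved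
for no curve by this file. THEOREMS ONLY: no definition, no named fact, no instance, no `sorry`.
References (shape only): [cite: Wiles1988, §2.2] [cite: Hida1986, Cor. 1.3, Cor. 1.4] [cite: KellerYin2024, Thm. 3.0.8, Thm. 2.2.2 (arXiv:2402.12781v2)] [cite: GreenbergVatsal2000, Thm. (1.3)]
-/

set_option autoImplicit false
set_option linter.dupNamespace false

noncomputable section

open scoped Classical MatrixGroups ModularForm

open CongruenceSubgroup WeierstrassCurve NumberField IsDedekindDomain Field PowerSeries
  Literature.NumberTheory.EllipticCurves Literature.NumberTheory.EllipticCurves.GreenbergSelmer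
  Literature.NumberTheory.EllipticCurves.ModularForms Literature.NumberTheory.QuadraticFields
  Literature.NumberTheory.EllipticCurves.Rank1Residual
  Literature.NumberTheory.EllipticCurves.Rank1Residual.Typed
  Literature.NumberTheory.EllipticCurves.KrizLi2019
  Literature.NumberTheory.EllipticCurves.GreenbergVatsal2000
  Literature.NumberTheory.EllipticCurves.Wuthrich2014
  Literature.NumberTheory.EllipticCurves.SteinWuthrich2013
  Literature.NumberTheory.EllipticCurves.Castella2018Exceptional
  Literature.NumberTheory.GaloisRepresentations Literature.NumberTheory.GaloisCohomology
  Literature.NumberTheory.Automorphic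
  Summit.BirchSwinnertonDyer.Rank1Residual.X11b.AcSelmer
  Summit.BirchSwinnertonDyer.Rank1Residual.X11b.Halves
  Summit.BirchSwinnertonDyer.Rank1Residual.X11b
  Summit.BirchSwinnertonDyer.Rank1Residual Summit.BirchSwinnertonDyer.Rank1Residual.X1
  Summit.BirchSwinnertonDyer.Rank1Residual.X2
open Literature.NumberTheory.EllipticCurves.KellerYin2024 (curveLocalLambda)


open Literature.NumberTheory.EllipticCurves.BigGaloisRep


namespace Summit.BirchSwinnertonDyer.BirchSwinnertonDyer.Theorems.EisensteinPrimesBSDpOnCellCOfCitedFactsV20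

open Literature.NumberTheory.EllipticCurves.CastellaGrossiLeeSkinner2022 Literature.NumberTheory.EllipticCurves.Castella2018
  Literature.NumberTheory.IwasawaTheory Literature.NumberTheory.IwasawaTheory.Greenberg2016
  Literature.NumberTheory.IwasawaTheory.Greenberg2006
  Summit.BirchSwinnertonDyer.Rank1Residual.X1.KellerYinMuLambdaSplit
open Literature.NumberTheory.EllipticCurves.KellerYin2024
open Summit.BirchSwinnertonDyer.BirchSwinnertonDyer.Theorems

/-- **Crux 4 `BSDpOnCellC` from the rational-chart cited fact T-An-2ʳ, the other cited facts and crux 3 (telescope v20, conditional closure).** Hypotheses = the texts of v20's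
four registered stubs token for token; proof = the v19 closure with the Galois lattice CONSTRUCTED by the landed bridge T-An-2ʳ → T-An-2ᶠ. CONDITIONAL: nothing here discharges the hypotheses.
[cite: Wiles1988, §2.2 (shape only)] [cite: KellerYin2024, Thm. 3.0.8 (shape only)] [cite: GreenbergVatsal2000, Thm. (1.3) (shape only)] -/
theorem bsdpOnCellC_of_citedFactsR
    (hPub :
    ((((lambdaMu_multiplicative_of_gvPar ∧ thm16_charIdeal_dvd_multiplicative_of_reducible ∧
    thm61_splitMultiplicative ∧ thm61_nonsplitMultiplicative ∧
    (∀ (W : WeierstrassCurve ℚ) [W.IsElliptic] [W.IsGloballyMinimal] (p : ℕ) [Fact p.Prime],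
      greenberg_stevens (W := W) (p := p)) ∧
    exists_isNewformOf ∧
    hsieh2014_exists_anticyclotomicPAdicLFunction ∧
    (∀ (N : ℕ) [NeZero N] (W : WeierstrassCurve ℚ) (K : Type) [Field K] [NumberField K],
      gross_zagier N W K) ∧
    (∀ (N : ℕ) [NeZero N] (W : WeierstrassCurve ℚ) (K : Type) [Field K] [NumberField K],
      kolyvagin N W K) ∧
    rank_eq_analyticRank_of_analyticRank_le_one ∧ HoffsteinLuo1997_exists_twist_L_one_ne_zero ∧
    mazur_not_dvd_maninConstant_of_odd ∧ bsdRHS_eq_of_isIsogenous) ∧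
    thm210_thm211_bdpDisplay_pNew) ∧
    LiuZhangZhang2018.thm151_thm153_modularCurve_heegnerVector) ∧
    (prop125_characterGrSelmerDual_torsion_muZero_dim ∧
      cor126_residualCharacter_globalLift ∧ cor126_residualCharacter_localSurjective ∧
      thm212_exists_isKatzLFunction ∧
      Literature.NumberTheory.EllipticCurves.Castella2018.cas20_thm211_memberForms_sigmaFrames_congr)) ∧
      Literature.NumberTheory.EllipticCurves.BCGKPST2020.thm331_rubin_exists_katzMeasure₂_pseudoIso_span_eq ∧
      Literature.NumberTheory.EllipticCurves.DeShalit1987.thmII64_katzMeasure₂_functionalEquation ∧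
      Literature.NumberTheory.EllipticCurves.Hida2010MuInvariant.thmI_mu_katzBranch_reflect_eq_zero)
    (hPre :
    Literature.NumberTheory.EllipticCurves.KellerYin2024.thm308_imc2_hidaMember_dvd_OPEN ∧
      Literature.NumberTheory.EllipticCurves.KellerYin2024.thm222_anacong_hidaMember_sigma_mu_OPEN ∧
      Literature.NumberTheory.EllipticCurves.KellerYin2024.thm222_anacong_hidaMember_sigma_lambda_OPEN ∧
      Literature.NumberTheory.EllipticCurves.KellerYin2024.thm308_imc2_hidaMember_isTorsion_OPEN)
    (hRat : Literature.NumberTheory.EllipticCurves.hida1986_castella2020_exists_rationalMembers_on_pNewBranchChart)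
    (hMazur :
    Summit.BirchSwinnertonDyer.BirchSwinnertonDyer.Theses.EisensteinPrimes.MazurMCOnCellB) :
    Summit.BirchSwinnertonDyer.BirchSwinnertonDyer.Theses.EisensteinPrimes.BSDpOnCellC :=
  EisensteinPrimesBSDpOnCellCOfCitedFactsV19.bsdpOnCellC_of_citedFactsF hPub hPre
    (Summit.BirchSwinnertonDyer.BirchSwinnertonDyer.Theorems.TelescopeBranchFrobeniusLatticeOfChart.frobeniusGaloisLattice_of_rationalMembers hRat) hMazur

end Summit.BirchSwinnertonDyer.BirchSwinnertonDyer.Theorems.EisensteinPrimesBSDpOnCellCOfCitedFactsV20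

end
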